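import Literature.AlgebraicGeometry.Milne1999.LefschetzGroupCMTorus
import Literature.AlgebraicGeometry.Milne1999.SpecialLefschetzGroupInvariantsCMType
import Literature.AlgebraicGeometry.Milne1999.MumfordTateGroupIsogeny
import HarnessLib

/-!
# `ker l` of a product of two Hom-orthogonal CM abelian varieties is the product torus `(ℂˣ)^Φ × (ℂˣ)^Ψ`
# (Milne 1999: Prop. 1.5 «`S(A) ≅ ∏ S(A_i)`» with Prop. 2.5 «`L(A_Ψ) = T^Ψ`» for a CM algebra with two factors)

Family `hodge`, layer `Literature/AlgebraicGeometry/Milne1999`, namespace `Literature.AlgebraicGeometry.Milne1999`.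
THEOREMS ONLY (no definition, no named fact; D-0026 net debt 0).

Milne [Milne1999LefschetzClasses, Prop. 1.5 (p. 644), Cor. 4.7 (p. 660)]: an isogeny `A → A₁^{r₁} × ⋯ × A_s^{r_s}` onto powers of
pairwise non-isogenous simple abelian varieties gives `S(A) ≅ ∏ S(A_i)` and `(L(A), l(A)) ≅ ∏ (L(A_i), l(A_i))` (fibre product over
`𝔾_m`); [Milne1999, §2 Prop. 2.5]: for a CM type `Ψ` on a CM ALGEBRA `E = ∏ E_i`, `(L(A_Ψ), l(A_Ψ)) = (T^Ψ, t^Ψ)` with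
`T^Ψ(ℚ) = {a ∈ E^× | a · ιa ∈ ℚ^×}`, so `ker t^Ψ = {a | a · ιa = 1}` splits over ℂ as `∏_i (ℂˣ)^{Φ_i}`.  The tree has the
one-field case (`Milne1999/LefschetzGroupCMTorus`: `ker l(A)(ℂ) ≃* (Φ → ℂˣ)` for a realisation of `(K; Φ)` with `θ(K) ⊆ C(A)`)
and the two-type splitting `ker l(X)(ℂ) ≅ ker l(B)(ℂ) × ker l(C)(ℂ)` for `X ∼ B^{r+1} × C^{s+1}`, `Hom(B, C) = 0 = Hom(C, B)`
(`Milne1999/LefschetzGroupFamilyStructure`).  This file composes them — the case of a CM algebra `K × K'` with two factors: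

* §1 for realisations `B` of `(K; Φ)` and `C` of `(K'; Ψ)` with `θ(K) ⊆ C(B)`, `θ'(K') ⊆ C(C)` and `Hom(B, C) = 0 = Hom(C, B)`:
  **`ker l(B × C)(ℂ) ≃* (Φ → ℂˣ) × (Ψ → ℂˣ)`** (`nonempty_specialLefschetzGroup_prod_mulEquiv_pi_units_prod`), the same for
  every `X ∼ B^{r+1} × C^{s+1}` (`…_of_isIsogenous_powSucc_prod_powSucc`), the split forms `≃* (Fin (dim B) → ℂˣ) × (Fin (dim C) → ℂˣ)`
  (a torus of rank `dim B + dim C = dim (B × C)`), and the SIMPLE NON-ISOGENOUS case where the Hom-orthogonality is automatic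
  (Mumford §19 Cor. 2; `…_of_isSimple`);
* §2 consequences for the Hodge group («`L(A) ⊃ Hg(A)`», p. 660): `Hg′(X)(ℂ)` EMBEDS in `(Φ → ℂˣ) × (Ψ → ℂˣ)`
  (`exists_injective_monoidHom_hodgeGroup_pi_units_prod_of_isIsogenous_powSucc_prod_powSucc`), in particular is commutative,
  and is ALL of it iff `X` is stably nondegenerate (Prop. 4.8 (a) ⟺ (c); `nonempty_hodgeGroup_mulEquiv_pi_units_prod_of_isStablyNondegenerate`).

## Sources read, verbatim

* J. S. Milne, *Lefschetz classes on abelian varieties*, Duke Math. J. 96 (1999) [`paper:doi-10-1215-s0012-7094-99-09620-5`],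
  §1 Prop. 1.5 (p. 644) «An isogeny `A → A₁^{r₁} × ⋯ × A_s^{r_s}` with the `A_i` simple and pairwise nonisogenous defines
  isomorphisms `C(A) ≅ ∏ M_{r_i}(C(A_i))`, `G(A) ≅ ∏ G(A_i)`, `S(A) ≅ ∏ S(A_i)`»; §4 p. 660 Cor. 4.7, «`L(A) ⊃ Hg(A)`», Prop. 4.8.
* J. S. Milne, *Lefschetz motives and the Tate conjecture*, Compositio Math. 117 (1999) [`paper:doi-10-1023-a-1000776613765`],
  §2 Prop. 2.5 «`(L(A_Ψ), l(A_Ψ)) = (T^Ψ, t^Ψ)`» (CM-type on a CM-algebra `E`, A.5–A.7).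
* D. Mumford, *Abelian varieties* (1970), §19 Cor. 2 of Thm. 1 (p. 174): a non-zero homomorphism of simple abelian varieties is
  an isogeny.

## References

* [Milne1999LefschetzClasses] J. S. Milne, Lefschetz classes on abelian varieties, Duke Math. J. 96 (1999): Prop. 1.5, Cor. 4.7,
  Prop. 4.8, §3 p. 657.
* [Milne1999] J. S. Milne, Lefschetz motives and the Tate conjecture, Compositio Math. 117 (1999): §2 Prop. 2.5, A.7.
* [MumfordAV1970] D. Mumford, Abelian varieties (1970), §19.
* [Gordon1999HodgeAVSurvey] B. B. Gordon, A survey of the Hodge conjecture for abelian varieties (1999), Thm. 7.5, Def. 7.6.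
-/

noncomputable section

open CategoryTheory NumberField
open Literature.AlgebraicTopology.SingularHomology
open Literature.AlgebraicGeometry.HodgeTheory
open Literature.AlgebraicGeometry.Motives
open Literature.AlgebraicGeometry.ComplexMultiplication (IsCMTypeRealisation)

namespace Literature.AlgebraicGeometry.Milne1999

variable {K : Type} [Field K] [NumberField K] [IsCMField K] {Φ : CMType K}
  {K' : Type} [Field K'] [NumberField K'] [IsCMField K'] {Ψ : CMType K'}
  {B C X : AbelianVariety ℂ} {ι : 𝓞 K →+* End B} {θ : K →+* Module.End ℂ (complexBetti B.X 1)}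
  {ι' : 𝓞 K' →+* End C} {θ' : K' →+* Module.End ℂ (complexBetti C.X 1)}

omit [IsCMField K] in
/-- A realisation has positive dimension. [folklore] -/
private theorem one_le_dim_of_realisation {A : AbelianVariety ℂ} {ιA : 𝓞 K →+* End A}
    {θA : K →+* Module.End ℂ (complexBetti A.X 1)} (hA : IsCMTypeRealisation Φ A ιA θA) : 1 ≤ A.dim := by
  have h1 := AbelianVariety.finrank_complexBetti_one A
  rw [hA.2.1] at h1
  have h2 : 0 < Module.finrank ℚ K := Module.finrank_pos
  omega

/-! ### §1 `ker l(B × C)(ℂ) ≃* (ℂˣ)^Φ × (ℂˣ)^Ψ` for Hom-orthogonal CM types -/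

section SpecialLefschetz

/-- **`ker l(B × C)(ℂ) ≃* (Φ → ℂˣ) × (Ψ → ℂˣ)`** for realisations `B` of `(K; Φ)` and `C` of `(K'; Ψ)` (`θ(K) ⊆ C(B)`,
`θ'(K') ⊆ C(C)`) with `Hom(B, C) = 0 = Hom(C, B)`: Prop. 1.5 «`S(A) ≅ ∏ S(A_i)`» composed with Prop. 2.5 on each factor — the
torus `ker t^Ψ` of the CM algebra `K × K'`. [cite: Milne1999LefschetzClasses, Prop. 1.5 (p. 644) and §3 p. 657]
[cite: Milne1999, §2 Prop. 2.5 and A.7] -/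
theorem nonempty_specialLefschetzGroup_prod_mulEquiv_pi_units_prod (hB : IsCMTypeRealisation Φ B ι θ)
    (hθ : ∀ a : K, θ a ∈ centralizerAlgebra B) (hC : IsCMTypeRealisation Ψ C ι' θ')
    (hθ' : ∀ a : K', θ' a ∈ centralizerAlgebra C) (hBC : ∀ f : B ⟶ C, f = 0) (hCB : ∀ g : C ⟶ B, g = 0) :
    Nonempty (specialLefschetzGroup (B.prod C).dim (B.prod C).X ≃* (Φ.1 → ℂˣ) × (Ψ.1 → ℂˣ)) := by
  obtain ⟨e⟩ := nonempty_specialLefschetzGroup_prod_mulEquiv hBC hCB (one_le_dim_of_realisation hB)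
    (one_le_dim_of_realisation hC)
  obtain ⟨eB⟩ := nonempty_specialLefschetzGroup_mulEquiv_pi_units hB hθ
  obtain ⟨eC⟩ := nonempty_specialLefschetzGroup_mulEquiv_pi_units hC hθ'
  exact ⟨e.trans (MulEquiv.prodCongr eB eC)⟩

/-- **`ker l(X)(ℂ) ≃* (Φ → ℂˣ) × (Ψ → ℂˣ)` for every `X ∼ B^{r+1} × C^{s+1}`** (`B`, `C` Hom-orthogonal CM realisations as
above): Cor. 4.7 with two isogeny types, read on the CM tori. [cite: Milne1999LefschetzClasses, Prop. 1.5 (p. 644) and Cor. 4.7 (p. 660)]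
[cite: Milne1999, §2 Prop. 2.5 and A.7] -/
theorem nonempty_specialLefschetzGroup_mulEquiv_pi_units_prod_of_isIsogenous_powSucc_prod_powSucc
    (hB : IsCMTypeRealisation Φ B ι θ) (hθ : ∀ a : K, θ a ∈ centralizerAlgebra B) (hC : IsCMTypeRealisation Ψ C ι' θ')
    (hθ' : ∀ a : K', θ' a ∈ centralizerAlgebra C) (hBC : ∀ f : B ⟶ C, f = 0) (hCB : ∀ g : C ⟶ B, g = 0) (r s : ℕ)
    (hX : AbelianVariety.IsIsogenous X ((B.powSucc r).prod (C.powSucc s))) :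
    Nonempty (specialLefschetzGroup X.dim X.X ≃* (Φ.1 → ℂˣ) × (Ψ.1 → ℂˣ)) := by
  obtain ⟨e⟩ := nonempty_specialLefschetzGroup_mulEquiv_prod_of_isIsogenous_powSucc_prod_powSucc hBC hCB
    (one_le_dim_of_realisation hB) (one_le_dim_of_realisation hC) r s hX
  obtain ⟨eB⟩ := nonempty_specialLefschetzGroup_mulEquiv_pi_units hB hθ
  obtain ⟨eC⟩ := nonempty_specialLefschetzGroup_mulEquiv_pi_units hC hθ'
  exact ⟨e.trans (MulEquiv.prodCongr eB eC)⟩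

/-- **`ker l(B × C)(ℂ) ≃* (ℂˣ)^{dim B} × (ℂˣ)^{dim C}`** — a split torus of rank `dim B + dim C = dim (B × C)` — for
Hom-orthogonal CM realisations `B`, `C`. [cite: Milne1999LefschetzClasses, Prop. 1.5 (p. 644) and §3 p. 657] [cite: Milne1999, §2 Prop. 2.5] -/
theorem nonempty_specialLefschetzGroup_prod_mulEquiv_fin_prod_fin (hB : IsCMTypeRealisation Φ B ι θ)
    (hθ : ∀ a : K, θ a ∈ centralizerAlgebra B) (hC : IsCMTypeRealisation Ψ C ι' θ')
    (hθ' : ∀ a : K', θ' a ∈ centralizerAlgebra C) (hBC : ∀ f : B ⟶ C, f = 0) (hCB : ∀ g : C ⟶ B, g = 0) :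
    Nonempty (specialLefschetzGroup (B.prod C).dim (B.prod C).X ≃* (Fin B.dim → ℂˣ) × (Fin C.dim → ℂˣ)) := by
  obtain ⟨e⟩ := nonempty_specialLefschetzGroup_prod_mulEquiv hBC hCB (one_le_dim_of_realisation hB)
    (one_le_dim_of_realisation hC)
  obtain ⟨eB⟩ := nonempty_specialLefschetzGroup_mulEquiv_fin hB hθ
  obtain ⟨eC⟩ := nonempty_specialLefschetzGroup_mulEquiv_fin hC hθ'
  exact ⟨e.trans (MulEquiv.prodCongr eB eC)⟩

/-- `ker l(X)(ℂ) ≃* (ℂˣ)^{dim B} × (ℂˣ)^{dim C}` for every `X ∼ B^{r+1} × C^{s+1}` (Hom-orthogonal CM realisations).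
[cite: Milne1999LefschetzClasses, Prop. 1.5 (p. 644) and Cor. 4.7 (p. 660)] [cite: Milne1999, §2 Prop. 2.5] -/
theorem nonempty_specialLefschetzGroup_mulEquiv_fin_prod_fin_of_isIsogenous_powSucc_prod_powSucc
    (hB : IsCMTypeRealisation Φ B ι θ) (hθ : ∀ a : K, θ a ∈ centralizerAlgebra B) (hC : IsCMTypeRealisation Ψ C ι' θ')
    (hθ' : ∀ a : K', θ' a ∈ centralizerAlgebra C) (hBC : ∀ f : B ⟶ C, f = 0) (hCB : ∀ g : C ⟶ B, g = 0) (r s : ℕ)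
    (hX : AbelianVariety.IsIsogenous X ((B.powSucc r).prod (C.powSucc s))) :
    Nonempty (specialLefschetzGroup X.dim X.X ≃* (Fin B.dim → ℂˣ) × (Fin C.dim → ℂˣ)) := by
  obtain ⟨e⟩ := nonempty_specialLefschetzGroup_mulEquiv_prod_of_isIsogenous_powSucc_prod_powSucc hBC hCB
    (one_le_dim_of_realisation hB) (one_le_dim_of_realisation hC) r s hX
  obtain ⟨eB⟩ := nonempty_specialLefschetzGroup_mulEquiv_fin hB hθ
  obtain ⟨eC⟩ := nonempty_specialLefschetzGroup_mulEquiv_fin hC hθ'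
  exact ⟨e.trans (MulEquiv.prodCongr eB eC)⟩

/-- **Two non-isogenous SIMPLE CM abelian varieties**: `ker l(B × C)(ℂ) ≃* (Φ → ℂˣ) × (Ψ → ℂˣ)` — Hom-orthogonality is automatic
(«a non-zero homomorphism between simple abelian varieties is an isogeny»). [cite: MumfordAV1970, §19 Cor. 2 of Thm. 1 (p. 174)]
[cite: Milne1999LefschetzClasses, Prop. 1.5 (p. 644)] [cite: Milne1999, §2 Prop. 2.5] -/
theorem nonempty_specialLefschetzGroup_prod_mulEquiv_pi_units_prod_of_isSimple (hB : IsCMTypeRealisation Φ B ι θ)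
    (hθ : ∀ a : K, θ a ∈ centralizerAlgebra B) (hC : IsCMTypeRealisation Ψ C ι' θ')
    (hθ' : ∀ a : K', θ' a ∈ centralizerAlgebra C) (hBs : AbelianVariety.IsSimple B) (hCs : AbelianVariety.IsSimple C)
    (hn : ¬ AbelianVariety.IsIsogenous B C) :
    Nonempty (specialLefschetzGroup (B.prod C).dim (B.prod C).X ≃* (Φ.1 → ℂˣ) × (Ψ.1 → ℂˣ)) :=
  nonempty_specialLefschetzGroup_prod_mulEquiv_pi_units_prod hB hθ hC hθ'
    (hom_eq_zero_of_isSimple_of_not_isIsogenous hBs hCs hn)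
    (hom_eq_zero_of_isSimple_of_not_isIsogenous hCs hBs fun h ↦ hn h.symm')

/-- Two non-isogenous simple CM abelian varieties, every `X ∼ B^{r+1} × C^{s+1}`: `ker l(X)(ℂ) ≃* (Φ → ℂˣ) × (Ψ → ℂˣ)`
(Prop. 1.5 verbatim shape: simple, pairwise non-isogenous factors). [cite: Milne1999LefschetzClasses, Prop. 1.5 (p. 644) and Cor. 4.7 (p. 660)]
[cite: Milne1999, §2 Prop. 2.5] [cite: MumfordAV1970, §19 Cor. 2 of Thm. 1 (p. 174)] -/
theorem nonempty_specialLefschetzGroup_mulEquiv_pi_units_prod_of_isSimple_of_isIsogenous_powSucc_prod_powSucc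
    (hB : IsCMTypeRealisation Φ B ι θ) (hθ : ∀ a : K, θ a ∈ centralizerAlgebra B) (hC : IsCMTypeRealisation Ψ C ι' θ')
    (hθ' : ∀ a : K', θ' a ∈ centralizerAlgebra C) (hBs : AbelianVariety.IsSimple B) (hCs : AbelianVariety.IsSimple C)
    (hn : ¬ AbelianVariety.IsIsogenous B C) (r s : ℕ) (hX : AbelianVariety.IsIsogenous X ((B.powSucc r).prod (C.powSucc s))) :
    Nonempty (specialLefschetzGroup X.dim X.X ≃* (Φ.1 → ℂˣ) × (Ψ.1 → ℂˣ)) :=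
  nonempty_specialLefschetzGroup_mulEquiv_pi_units_prod_of_isIsogenous_powSucc_prod_powSucc hB hθ hC hθ'
    (hom_eq_zero_of_isSimple_of_not_isIsogenous hBs hCs hn)
    (hom_eq_zero_of_isSimple_of_not_isIsogenous hCs hBs fun h ↦ hn h.symm') r s hX

end SpecialLefschetz

/-! ### §2 The Hodge group inside the product torus -/

section Hodge

/-- **`Hg′(X)(ℂ)` embeds in `(Φ → ℂˣ) × (Ψ → ℂˣ)`** for every `X ∼ B^{r+1} × C^{s+1}` (Hom-orthogonal CM realisations `B`, `C`):
`Hg′(X) ≤ ker l(X)` («`L(A) ⊃ Hg(A)`») and §1; in particular `Hg′(X)(ℂ)` is a commutative subgroup of a split torus of rank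
`dim B + dim C`. [cite: Milne1999LefschetzClasses, §4 p. 660 (L(A) ⊃ Hg(A)), Prop. 1.5 and Cor. 4.7] [cite: Milne1999, §2 Prop. 2.5] -/
theorem exists_injective_monoidHom_hodgeGroup_pi_units_prod_of_isIsogenous_powSucc_prod_powSucc
    (hB : IsCMTypeRealisation Φ B ι θ) (hθ : ∀ a : K, θ a ∈ centralizerAlgebra B) (hC : IsCMTypeRealisation Ψ C ι' θ')
    (hθ' : ∀ a : K', θ' a ∈ centralizerAlgebra C) (hBC : ∀ f : B ⟶ C, f = 0) (hCB : ∀ g : C ⟶ B, g = 0) (r s : ℕ)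
    (hX : AbelianVariety.IsIsogenous X ((B.powSucc r).prod (C.powSucc s))) :
    ∃ f : hodgeGroup X.dim X.X →* (Φ.1 → ℂˣ) × (Ψ.1 → ℂˣ), Function.Injective f := by
  obtain ⟨e⟩ := nonempty_specialLefschetzGroup_mulEquiv_pi_units_prod_of_isIsogenous_powSucc_prod_powSucc hB hθ hC hθ'
    hBC hCB r s hX
  exact ⟨e.toMonoidHom.comp (Subgroup.inclusion X.hodgeGroup_le_specialLefschetzGroup.1),
    e.injective.comp (Subgroup.inclusion_injective _)⟩

/-- `Hg′(X)(ℂ)` is commutative for every `X ∼ B^{r+1} × C^{s+1}`, `B`, `C` Hom-orthogonal CM realisations (a subgroup of a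
torus). [cite: Milne1999LefschetzClasses, §4 p. 660 and Prop. 1.5] [cite: Deligne1982HodgeCycles, I §5] -/
theorem hodgeGroup_comm_of_isIsogenous_powSucc_prod_powSucc (hB : IsCMTypeRealisation Φ B ι θ)
    (hθ : ∀ a : K, θ a ∈ centralizerAlgebra B) (hC : IsCMTypeRealisation Ψ C ι' θ')
    (hθ' : ∀ a : K', θ' a ∈ centralizerAlgebra C) (hBC : ∀ f : B ⟶ C, f = 0) (hCB : ∀ g : C ⟶ B, g = 0) (r s : ℕ)
    (hX : AbelianVariety.IsIsogenous X ((B.powSucc r).prod (C.powSucc s)))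
    {g g' : ∀ k : ℕ, complexBetti X.X k ≃ₗ[ℂ] complexBetti X.X k} (hg : g ∈ hodgeGroup X.dim X.X)
    (hg' : g' ∈ hodgeGroup X.dim X.X) : g * g' = g' * g := by
  obtain ⟨f, hf⟩ := exists_injective_monoidHom_hodgeGroup_pi_units_prod_of_isIsogenous_powSucc_prod_powSucc hB hθ hC hθ'
    hBC hCB r s hX
  have h := mul_comm (f ⟨g, hg⟩) (f ⟨g', hg'⟩)
  rw [← map_mul, ← map_mul] at h
  exact congrArg Subtype.val (hf h)

/-- **`Hg′(X)(ℂ) ≃* (Φ → ℂˣ) × (Ψ → ℂˣ)` iff-free form: if `X ∼ B^{r+1} × C^{s+1}` is STABLY NONDEGENERATE** (no power supports an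
exotic Hodge class; Prop. 4.8 (a) ⟹ (c), `Hg′(X) = ker l(X)`) then its Hodge group is the whole product torus.
[cite: Milne1999LefschetzClasses, Prop. 4.8 (p. 660), Prop. 1.5 and Cor. 4.7] [cite: Gordon1999HodgeAVSurvey, Thm. 7.5 and Def. 7.6]
[cite: Milne1999, §2 Prop. 2.5] -/
theorem nonempty_hodgeGroup_mulEquiv_pi_units_prod_of_isStablyNondegenerate (hB : IsCMTypeRealisation Φ B ι θ)
    (hθ : ∀ a : K, θ a ∈ centralizerAlgebra B) (hC : IsCMTypeRealisation Ψ C ι' θ')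
    (hθ' : ∀ a : K', θ' a ∈ centralizerAlgebra C) (hBC : ∀ f : B ⟶ C, f = 0) (hCB : ∀ g : C ⟶ B, g = 0) (r s : ℕ)
    (hX : AbelianVariety.IsIsogenous X ((B.powSucc r).prod (C.powSucc s))) (hS : IsStablyNondegenerate X) :
    Nonempty (hodgeGroup X.dim X.X ≃* (Φ.1 → ℂˣ) × (Ψ.1 → ℂˣ)) := by
  obtain ⟨e⟩ := nonempty_specialLefschetzGroup_mulEquiv_pi_units_prod_of_isIsogenous_powSucc_prod_powSucc hB hθ hC hθ'
    hBC hCB r s hX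
  exact ⟨(MulEquiv.subgroupCongr (X.hodgeGroup_eq_specialLefschetzGroup_iff_forall_isDivisorGenerated.2 hS)).trans e⟩

/-- The product case `X = B × C`: `Hg′(B × C)(ℂ) ≃* (Φ → ℂˣ) × (Ψ → ℂˣ)` when `B × C` is stably nondegenerate (Hom-orthogonal CM
realisations). [cite: Milne1999LefschetzClasses, Prop. 4.8 (p. 660) and Prop. 1.5] [cite: Milne1999, §2 Prop. 2.5] -/
theorem nonempty_hodgeGroup_prod_mulEquiv_pi_units_prod_of_isStablyNondegenerate (hB : IsCMTypeRealisation Φ B ι θ)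
    (hθ : ∀ a : K, θ a ∈ centralizerAlgebra B) (hC : IsCMTypeRealisation Ψ C ι' θ')
    (hθ' : ∀ a : K', θ' a ∈ centralizerAlgebra C) (hBC : ∀ f : B ⟶ C, f = 0) (hCB : ∀ g : C ⟶ B, g = 0)
    (hS : IsStablyNondegenerate (B.prod C)) :
    Nonempty (hodgeGroup (B.prod C).dim (B.prod C).X ≃* (Φ.1 → ℂˣ) × (Ψ.1 → ℂˣ)) := by
  obtain ⟨e⟩ := nonempty_specialLefschetzGroup_prod_mulEquiv_pi_units_prod hB hθ hC hθ' hBC hCB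
  exact ⟨(MulEquiv.subgroupCongr ((B.prod C).hodgeGroup_eq_specialLefschetzGroup_iff_forall_isDivisorGenerated.2 hS)).trans e⟩

end Hodge

end Literature.AlgebraicGeometry.Milne1999

end
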